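import Literature.Algebra.Homology.FreeAbelianGroupHomologyField
import Literature.Algebra.Homology.FreeAbelianCohomologyDeterminant
import HarnessLib

/-!
# Endomorphisms of the lattice `Λ = ℤ^ι` on its HOMOLOGY over a field: `α_* = det(α^*|H¹)` on the top
# degree `H_{|ι|}(Λ, K)` (`α_*[Λ] = deg(α) · [Λ]`), and `[n]_* = nᵖ` on `H_p(Λ, K)`
# (Lange 2023 Prop. 1.1.13 (c), Prop. 1.1.14; Bourbaki A III §8 no. 1 (1); Brown V §6 Thm. 6.4)

Topic `Algebra/Homology`; namespace `Literature.Algebra.Homology`.  Theorems only; NO definition, NO named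
fact, no `sorry`.  Lane `lit-hodgefound` (Track 2, Layer A), seat p30 gen 14, row g14-#11 of
`run/shared/lean/pub/lit-hodgefound/SKELETON.md`.  The HOMOLOGY faces, by Kronecker duality over a field
(rows g14-#1 = Q2310 `forall_kroneckerPairingTrivial_eq_zero_iff_of_field` and g13-#3
`kroneckerPairingTrivial_naturality`: `⟨α^* x, z⟩ = ⟨x, α_* z⟩`), of the tree's COHOMOLOGY file
`FreeAbelianCohomologyDeterminant` (seat p30 gen 9: `map_top_eq_det_smul` — `α^* = det(α^*|H¹)` on
`H^d(G, k)`; `map_eq_pow_smul_of_map_one`, `map_zpowGroupHom_eq_pow_smul` — `[n]^* = nᵖ` on `Hᵖ`;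
`map_invMonoidHom_eq_pow_smul`), read on Mathlib's genuine `groupHomology` of the lattice with the
fundamental class `[Λ]_K = latticeFundamentalClass K ι` of row g14-#2 (= Q2324).

Sources followed.  H. Lange, *Abelian Varieties over the Complex Numbers* (Springer 2023) [held
`book:lange1992-complex-abelian-varieties`], §1.1.2 Prop. 1.1.13 (c) (`deg f = det ρ_r(f)` for an isogeny
`f`, `ρ_r` the rational = lattice representation) and Prop. 1.1.14 (`deg n_X = n^{2g}`): on the
fundamental class of the real torus `X = V/Λ`, `H_{2g}(X, ℤ) = H_{2g}(Λ, ℤ)`, an endomorphism with lattice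
matrix `A` acts as `det A`, and `n_X` as `n^{2g}`; N. Bourbaki, *Algebra I* Ch. III §8 no. 1 formula (1)
(`⋀ⁿ(u)` is the homothety of ratio `det u`); K. S. Brown, *Cohomology of Groups* V §6 Thm. 6.4
(`H_*(ℤ^d, k) = ⋀_*(k^d)` naturally) and V §3 (3.7) p. 114 (`⟨α^* u, z⟩ = ⟨u, α_* z⟩`).

## Contents (`K` a field, `ι` finite, `d = |ι|`, `α : Λ →* Λ`, `α_* = homologyPushforward K α`,
`α^* = cohomologyPullback K α`)
* `homologyPushforward_eq_smul_of_cohomologyPullback_eq_smul` (any group, by duality: `α^* = c` on `Hᵖ ⟹ α_* = c` on `H_p`);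
* **`homologyPushforward_top_eq_det_smul`** — `α_* z = det(α^*|H¹(Λ, K)) • z` for every `z ∈ H_d(Λ, K)`;
  **`homologyPushforward_latticeFundamentalClass`** — `α_* [Λ]_K = det(α^*|H¹(Λ, K)) • [Λ]_K`;
* `homologyPushforward_eq_pow_smul_of_map_one` — `α^* = c` on `H¹ ⟹ α_* = cᵖ` on `H_p`;
  **`homologyPushforward_zpowGroupHom_eq_pow_smul`** — `[n]_* z = nᵖ • z` on `H_p(Λ, K)`;
  `homologyPushforward_zpowGroupHom_latticeFundamentalClass` — `[n]_* [Λ]_K = n^d • [Λ]_K`;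
  `homologyPushforward_invMonoidHom_eq_pow_smul` — `(·)⁻¹_* = (−1)ᵖ` on `H_p(Λ, K)`.

## References
* H. Lange, *Abelian Varieties over the Complex Numbers*, Springer (2023), §1.1.2 Prop. 1.1.13 (c),
  Prop. 1.1.14. [Lange2023AbelianVarietiesComplex]
* N. Bourbaki, *Algèbre, Chapitres 1 à 3*, Ch. III §8 no. 1 formula (1), §7 no. 2 formula (4). [BourbakiAlgebre1a3]
* K. S. Brown, *Cohomology of Groups*, GTM 87, Springer (1982), V §6 Thm. 6.4, V §3 (3.7) p. 114. [Brown1982CohomologyGroups]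
-/

noncomputable section

open Function Module CategoryTheory groupCohomology groupHomology Multiplicative
open Literature.Algebra.Homology.GroupKronecker

namespace Literature.Algebra.Homology

section AnyGroup

universe w

variable (K : Type w) {G : Type w} [Field K] [Group G]

/-- Transport of a scalar identity from cohomology to homology by duality (any group `G`, field `K`):
if `α^* = c` on `Hᵖ(G, K)` then `α_* = c` on `H_p(G, K)` (`⟨x, α_* z⟩ = ⟨α^* x, z⟩ = c ⟨x, z⟩` for all
`x`, and the pairing separates `H_p`). [cite: Brown1982CohomologyGroups, V §3 (3.7) p. 114] [cite: CartanEilenberg1956, VI §5 Prop. 5.1 pp. 119–120] -/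
theorem homologyPushforward_eq_smul_of_cohomologyPullback_eq_smul (α : G →* G) (p : ℕ) (c : K)
    (hα : ∀ x : groupCohomology (Rep.trivial K G K) p, (cohomologyPullback K α p).hom x = c • x)
    (z : groupHomology (Rep.trivial K G K) p) :
    (homologyPushforward K α p).hom z = c • z := by
  rw [← sub_eq_zero, ← forall_kroneckerPairingTrivial_eq_zero_iff_of_field K G p]
  intro x
  rw [map_sub, map_smul, ← kroneckerPairingTrivial_naturality, hα, map_smul, LinearMap.smul_apply,
    sub_self]

end AnyGroup

section Lattice

variable (K : Type) [Field K] (ι : Type) [Fintype ι] [DecidableEq ι]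

/-- **`α_* = det(α^*|H¹(Λ, K))` on the top homology `H_d(Λ, K)`** (`d = |ι|`) for every endomorphism `α`
of the lattice: the homology face of "`⋀^d(u)` is the homothety of ratio `det u`" / "`deg f = det ρ_r(f)`".
[cite: Lange2023AbelianVarietiesComplex, §1.1.2 Prop. 1.1.13 (c)] [cite: BourbakiAlgebre1a3, Ch. III §8 no. 1 formula (1)] [cite: Brown1982CohomologyGroups, V §6 Thm. 6.4] -/
theorem homologyPushforward_top_eq_det_smul (α : Multiplicative (ι → ℤ) →* Multiplicative (ι → ℤ))
    (z : groupHomology (Rep.trivial K (Multiplicative (ι → ℤ)) K) (Fintype.card ι)) :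
    (homologyPushforward K α (Fintype.card ι)).hom z =
      LinearMap.det (cohomologyPullback K α 1).hom • z :=
  homologyPushforward_eq_smul_of_cohomologyPullback_eq_smul K α _ _
    (fun x => map_top_eq_det_smul (piZBasis (Fintype.equivFin ι).symm) (piZBasis_gen _) (piZBasis_ind _)
      α x) z

/-- **`α_* [Λ]_K = det(α^*|H¹(Λ, K)) • [Λ]_K`**: an endomorphism multiplies the fundamental class by its
determinant ("`deg f = det ρ_r(f)`"). [cite: Lange2023AbelianVarietiesComplex, §1.1.2 Prop. 1.1.13 (c)] [cite: BourbakiAlgebre1a3, Ch. III §8 no. 1 formula (1)] -/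
theorem homologyPushforward_latticeFundamentalClass
    (α : Multiplicative (ι → ℤ) →* Multiplicative (ι → ℤ)) :
    (homologyPushforward K α (Fintype.card ι)).hom (latticeFundamentalClass K ι) =
      LinearMap.det (cohomologyPullback K α 1).hom • latticeFundamentalClass K ι :=
  homologyPushforward_top_eq_det_smul K ι α _

/-- If `α^*` is the scalar `c` on `H¹(Λ, K)` then `α_*` is `cᵖ` on `H_p(Λ, K)` (`⋀ᵖ(c) = cᵖ`, dualised).
[cite: BourbakiAlgebre1a3, Ch. III §7 no. 2 formula (4)] [cite: Brown1982CohomologyGroups, V §6 Thm. 6.4 and V §3 (3.7)] -/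
theorem homologyPushforward_eq_pow_smul_of_map_one
    (α : Multiplicative (ι → ℤ) →* Multiplicative (ι → ℤ)) (c : K)
    (hα : ∀ u : cohomologyGrade K (Multiplicative (ι → ℤ)) 1, (cohomologyPullback K α 1).hom u = c • u)
    (p : ℕ) (z : groupHomology (Rep.trivial K (Multiplicative (ι → ℤ)) K) p) :
    (homologyPushforward K α p).hom z = c ^ p • z :=
  homologyPushforward_eq_smul_of_cohomologyPullback_eq_smul K α p _
    (fun x => map_eq_pow_smul_of_map_one (piZBasis (Fintype.equivFin ι).symm) (piZBasis_gen _)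
      (piZBasis_ind _) α c hα p x) z

/-- **`[n]_* = nᵖ` on `H_p(Λ, K)`**: the `n`-th power endomorphism of the lattice (multiplication by `n`
on `ℤ^ι`, the isogeny `n_X` of the torus) acts on `H_p` as `nᵖ`.
[cite: Lange2023AbelianVarietiesComplex, §1.1.2 Prop. 1.1.14] [cite: BourbakiAlgebre1a3, Ch. III §7 no. 2 formula (4)] [cite: Brown1982CohomologyGroups, V §6 Thm. 6.4] -/
theorem homologyPushforward_zpowGroupHom_eq_pow_smul (n : ℤ) (p : ℕ)
    (z : groupHomology (Rep.trivial K (Multiplicative (ι → ℤ)) K) p) :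
    (homologyPushforward K (zpowGroupHom n : Multiplicative (ι → ℤ) →* Multiplicative (ι → ℤ)) p).hom z =
      ((n : K) ^ p) • z :=
  homologyPushforward_eq_smul_of_cohomologyPullback_eq_smul K _ p _
    (fun x => map_zpowGroupHom_eq_pow_smul (piZBasis (Fintype.equivFin ι).symm) (piZBasis_gen _)
      (piZBasis_ind _) n p x) z

/-- **`[n]_* [Λ]_K = n^d • [Λ]_K`** (`d = |ι|`): "`deg n_X = n^{2g}`" on the fundamental class.
[cite: Lange2023AbelianVarietiesComplex, §1.1.2 Prop. 1.1.14] -/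
theorem homologyPushforward_zpowGroupHom_latticeFundamentalClass (n : ℤ) :
    (homologyPushforward K (zpowGroupHom n : Multiplicative (ι → ℤ) →* Multiplicative (ι → ℤ))
        (Fintype.card ι)).hom (latticeFundamentalClass K ι) =
      ((n : K) ^ Fintype.card ι) • latticeFundamentalClass K ι :=
  homologyPushforward_zpowGroupHom_eq_pow_smul K ι n _ _

/-- **`(·)⁻¹_* = (−1)ᵖ` on `H_p(Λ, K)`**: inversion of the lattice (the involution `−1_X` of the torus)
acts on `H_p` by the sign `(−1)ᵖ`. [cite: BourbakiAlgebre1a3, Ch. III §7 no. 2 formula (4)] [cite: Brown1982CohomologyGroups, V §6 Thm. 6.4] -/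
theorem homologyPushforward_invMonoidHom_eq_pow_smul (p : ℕ)
    (z : groupHomology (Rep.trivial K (Multiplicative (ι → ℤ)) K) p) :
    (homologyPushforward K (invMonoidHom : Multiplicative (ι → ℤ) →* Multiplicative (ι → ℤ)) p).hom z =
      ((-1 : K) ^ p) • z :=
  homologyPushforward_eq_smul_of_cohomologyPullback_eq_smul K _ p _
    (fun x => map_invMonoidHom_eq_pow_smul (piZBasis (Fintype.equivFin ι).symm) (piZBasis_gen _)
      (piZBasis_ind _) p x) z

end Lattice

end Literature.Algebra.Homology
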